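import Summits.NavierStokesRegularity.NavierStokesRegularity.Theorems.ExtremiserTransienceWeakClassLocalEnergyHead
import HarnessLib

/-!
# Route `ExtremiserTransience`, LINE g5-α repair (seat ns-idea-5 g5): interval integrability of the gauge-free energy flux

`--supports stmt-NavierStokesRegularity-27823`.  Route-independent companion of `weakClass_localEnergy_head` (p640551): the time integrand
`s ↦ ∫ (Δχ_ρ |W s|² + Dχ_ρ(W s)|W s|² + 2 (Q̃_s − Q̃_s(0)) Dχ_ρ(W s))` of the head inequality is INTERVAL INTEGRABLE on `[t₀ − ρ², t₀]`
(it coincides there with the classical flux `s ↦ ∫ (…) + 2 q Dχ_ρ(W s)`, continuous by `IsClassicalNSSolutionOn.continuousOn_integral_flux_cutoff`).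
This is exactly what `intervalIntegral.integral_mono_on` needs in §RECIPE step 4 (bounding the head's right-hand side by `C ρ^{5/2}`); the
conjunction `weakClass_localEnergy_head'` packages inequality + integrability.  HONEST FRAMING: bookkeeping for hypothetical blow-up limits;
nothing about Navier–Stokes regularity or blow-up is proved here and no summit is proved by a line. [cite: CaffarelliKohnNirenberg1982, §2 (2.5)]
-/

noncomputable section

namespace Summit.NavierStokesRegularity.NavierStokesRegularity.Theorems.ExtremiserTransience
set_option linter.dupNamespace false

open Set Function MeasureTheory Filter Topology
open scoped RealInnerProductSpace ContDiff Laplacian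
open Literature.Analysis Literature.Analysis.FluidPDE

/-- Interval integrability on `[t₀ − ρ², t₀]` of the gauge-free energy flux of a weak-class field. [cite: CaffarelliKohnNirenberg1982, §2 (2.5)] -/
theorem weakClass_flux_intervalIntegrable (W : ℝ → EuclideanSpace ℝ (Fin 3) → EuclideanSpace ℝ (Fin 3)) (K : ℝ)
    (hcont : ContinuousOn (Function.uncurry W) (Set.Iio (0 : ℝ) ×ˢ Set.univ))
    (hmild : ∀ s t : ℝ, s < t → t < 0 → ∀ x, W t x =
      Literature.Analysis.FluidPDE.heatFlow (W s) (t - s) x - Literature.Analysis.FluidPDE.oseenDuhamel 1 s W W t x)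
    (hdec : ∀ t : ℝ, t < 0 → ∀ x, Real.sqrt (-t) * ‖W t x‖ ≤ K) {t₀ ρ : ℝ} (ht₀ : t₀ < 0) (hρ : 0 < ρ) :
    IntervalIntegrable (fun s => ∫ x, ((Δ (cutoff ρ : EuclideanSpace ℝ (Fin 3) → ℝ)) x * ‖W s x‖ ^ 2 +
          fderiv ℝ (cutoff ρ) x (W s x) * ‖W s x‖ ^ 2 +
          2 * ((pressurePotentialMod 0 (W s) x - pressurePotentialMod 0 (W s) 0) * fderiv ℝ (cutoff ρ) x (W s x))))
      volume (t₀ - ρ ^ 2) t₀ := by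
  have hwdiv := weakClass_isWeaklyDivFree W K hcont hmild hdec
  obtain ⟨K₁, -, hg⟩ := weakClass_gradTypeI W K hcont hmild hdec
  have hT : t₀ - ρ ^ 2 - 1 < 0 := by nlinarith
  obtain ⟨q, hq, hid⟩ := weakClass_pressure_window W K hcont hmild hdec hT
  set φ : EuclideanSpace ℝ (Fin 3) → ℝ := cutoff ρ with hφdef
  have hφ : ContDiff ℝ ∞ φ := contDiff_cutoff ρ
  have hφc : HasCompactSupport φ := hasCompactSupport_cutoff hρ
  have hle : t₀ - ρ ^ 2 ≤ t₀ := by nlinarith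
  have hI : Icc (t₀ - ρ ^ 2) t₀ ⊆ Ioo (t₀ - ρ ^ 2 - 1) 0 := fun s hs => ⟨by linarith [hs.1], lt_of_le_of_lt hs.2 ht₀⟩
  have hcF := hq.continuousOn_integral_flux_cutoff hφ hφc
  have hFi := (hcF.mono hI).intervalIntegrable_of_Icc (μ := volume) hle
  have hDφ : Continuous (fderiv ℝ φ) := hφ.continuous_fderiv (by simp)
  have hDφc : HasCompactSupport (fderiv ℝ φ) := hφc.fderiv (𝕜 := ℝ)
  have hΔφ : Continuous (Δ φ) := continuous_laplacian (hφ.of_le (by norm_cast))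
  have hΔφc : HasCompactSupport (Δ φ) :=
    hφc.mono' fun x hx => by
      by_contra h
      exact hx (laplacian_eq_zero_of_notMem_tsupport h)
  have hflux : ∀ s ∈ uIcc (t₀ - ρ ^ 2) t₀,
      (∫ x, ((Δ φ) x * ‖W s x‖ ^ 2 + fderiv ℝ φ x (W s x) * ‖W s x‖ ^ 2 + 2 * (q s x * fderiv ℝ φ x (W s x)))) =
        ∫ x, ((Δ φ) x * ‖W s x‖ ^ 2 + fderiv ℝ φ x (W s x) * ‖W s x‖ ^ 2 +
          2 * ((pressurePotentialMod 0 (W s) x - pressurePotentialMod 0 (W s) 0) * fderiv ℝ φ x (W s x))) := by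
    intro s hs
    rw [uIcc_of_le hle] at hs
    have hsS : s ∈ Ioo (t₀ - ρ ^ 2 - 1) 0 := hI hs
    have hs0 : s < 0 := hsS.2
    have hWc : Continuous (W s) := (hg s hs0).1.continuous
    have hqc : Continuous (q s) := by
      have h1 := hq.smooth_pressure.continuousOn
      exact h1.comp_continuous (continuous_const.prodMk continuous_id) fun x => ⟨hsS, mem_univ _⟩
    obtain ⟨c, hc⟩ := hid s hsS 0
    have hF : Continuous fun x => fderiv ℝ φ x (W s x) := hDφ.clm_apply hWc
    have hFc : HasCompactSupport fun x => fderiv ℝ φ x (W s x) := by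
      refine hDφc.mono (Function.support_subset_iff'.2 fun x hx => ?_)
      rw [Function.notMem_support] at hx
      simp [hx]
    have hA : Integrable (fun x => (Δ φ) x * ‖W s x‖ ^ 2 + fderiv ℝ φ x (W s x) * ‖W s x‖ ^ 2) volume :=
      ((hΔφ.mul (hWc.norm.pow 2)).integrable_of_hasCompactSupport hΔφc.mul_right).add
        ((hF.mul (hWc.norm.pow 2)).integrable_of_hasCompactSupport hFc.mul_right)
    have hP1 : Integrable (fun x => 2 * (q s x * fderiv ℝ φ x (W s x))) volume :=
      ((hqc.mul hF).integrable_of_hasCompactSupport hFc.mul_left).const_mul 2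
    have hPc : Continuous fun x => pressurePotentialMod 0 (W s) x - pressurePotentialMod 0 (W s) 0 := by
      have e : (fun x => pressurePotentialMod 0 (W s) x - pressurePotentialMod 0 (W s) 0) = fun x => q s x - (c + pressurePotentialMod 0 (W s) 0) := by
        funext x; rw [hc x]; ring
      rw [e]; exact hqc.sub continuous_const
    have hP2 : Integrable (fun x => 2 * ((pressurePotentialMod 0 (W s) x - pressurePotentialMod 0 (W s) 0) * fderiv ℝ φ x (W s x))) volume :=
      ((hPc.mul hF).integrable_of_hasCompactSupport hFc.mul_left).const_mul 2
    rw [integral_add hA hP1, integral_add hA hP2, integral_const_mul, integral_const_mul]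
    congr 2
    rw [integral_mul_fderiv_apply_eq_of_sub_const (hwdiv s hs0) hWc hqc hφ hφc (c + pressurePotentialMod 0 (W s) 0)]
    refine integral_congr_ae (Eventually.of_forall fun x => ?_)
    simp only
    rw [hc x]
    ring
  refine hFi.congr_ae ((ae_restrict_mem measurableSet_uIoc).mono fun s hs => ?_)
  have hs' : s ∈ uIcc (t₀ - ρ ^ 2) t₀ := uIoc_subset_uIcc hs
  simp only [one_mul]
  exact hflux s hs'

/-- `weakClass_localEnergy_head` packaged with the interval integrability of its flux integrand (the form §RECIPE step 4 consumes).
[cite: CaffarelliKohnNirenberg1982, §2 (2.5)] -/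
theorem weakClass_localEnergy_head' (W : ℝ → EuclideanSpace ℝ (Fin 3) → EuclideanSpace ℝ (Fin 3)) (K : ℝ)
    (hcont : ContinuousOn (Function.uncurry W) (Set.Iio (0 : ℝ) ×ˢ Set.univ))
    (hmild : ∀ s t : ℝ, s < t → t < 0 → ∀ x, W t x =
      Literature.Analysis.FluidPDE.heatFlow (W s) (t - s) x - Literature.Analysis.FluidPDE.oseenDuhamel 1 s W W t x)
    (hdec : ∀ t : ℝ, t < 0 → ∀ x, Real.sqrt (-t) * ‖W t x‖ ≤ K) {t₀ ρ : ℝ} (ht₀ : t₀ < 0) (hρ : 0 < ρ) :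
    (∫ x, cutoff ρ x * ‖W t₀ x‖ ^ 2 ≤
      (∫ x, cutoff ρ x * ‖W (t₀ - ρ ^ 2) x‖ ^ 2) +
        ∫ s in (t₀ - ρ ^ 2)..t₀, ∫ x, ((Δ (cutoff ρ : EuclideanSpace ℝ (Fin 3) → ℝ)) x * ‖W s x‖ ^ 2 +
          fderiv ℝ (cutoff ρ) x (W s x) * ‖W s x‖ ^ 2 +
          2 * ((pressurePotentialMod 0 (W s) x - pressurePotentialMod 0 (W s) 0) * fderiv ℝ (cutoff ρ) x (W s x)))) ∧
    IntervalIntegrable (fun s => ∫ x, ((Δ (cutoff ρ : EuclideanSpace ℝ (Fin 3) → ℝ)) x * ‖W s x‖ ^ 2 +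
          fderiv ℝ (cutoff ρ) x (W s x) * ‖W s x‖ ^ 2 +
          2 * ((pressurePotentialMod 0 (W s) x - pressurePotentialMod 0 (W s) 0) * fderiv ℝ (cutoff ρ) x (W s x))))
      volume (t₀ - ρ ^ 2) t₀ :=
  ⟨weakClass_localEnergy_head W K hcont hmild hdec ht₀ hρ, weakClass_flux_intervalIntegrable W K hcont hmild hdec ht₀ hρ⟩

end Summit.NavierStokesRegularity.NavierStokesRegularity.Theorems.ExtremiserTransience

end
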